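import Mathlib
import HarnessLib

/-!
# Stub `stub_ahlforsOsserman` of line `Sketch` for crux `HyperbolicEnd`
(item stmt-SmoothPoincare4-7825, route `SullivanDual`)

**Ahlfors–Schwarz / Osserman on the plane.** A `C²` function `λ ≥ 0` on `ℂ` with
`2c λ³ ≤ λ Δλ - |∇λ|²` everywhere (`c > 0`, `|∇λ|² = (∂ₓλ)² + (∂_yλ)²`, `Δ` Mathlib's Laplacian
of the real inner product space `ℂ`) vanishes identically: the plane carries no pseudo-metric
`λ|dz|²` of curvature `≤ -c < 0` (Ahlfors 1938; Osserman's form of the Liouville theorem for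
`Δ log λ ≥ 2cλ`).

Proof (log-free maximum principle, everything is one-point calculus).  Fix `R > 0` and compare
with the weight `(R² - |z|²)²` of the Poincaré density of the disc `D_R`: the continuous function
`q = λ · (R² - |z|²)²` attains its maximum over the closed disc at some `z₂`; if the maximum is
positive, `z₂` is interior with `λ(z₂) > 0`, and along the two lines `t ↦ z₂ + t`, `t ↦ z₂ + tI`
the first derivative of `q` vanishes and the second is `≤ 0` (`line_test`).  Feeding these four
relations and the hypothesis at `z₂` into elementary algebra (`algebra_step`) gives
`c · q(z₂) ≤ 4R²`, whence `c λ(z) (R² - |z|²)² ≤ 4R²` on the whole disc (`bound_on_disc`).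
Letting `R → ∞` at a fixed `z` forces `λ(z) = 0`.

References: L. V. Ahlfors, *An extension of Schwarz's lemma*, Trans. AMS 43 (1938) 359–364;
R. Osserman, *On the inequality `Δu ≥ f(u)`*, Pacific J. Math. 7 (1957) 1641–1647.
No named facts are used; the statement is flat (Mathlib-level).
-/

noncomputable section

-- the prescribed crux namespace repeats the component `SmoothPoincare4`
set_option linter.dupNamespace false

open scoped Manifold ContDiff Topology
open Laplacian Set

namespace Summit.SmoothPoincare4.SmoothPoincare4.Cruxes.HyperbolicEnd.Sketch

/-! ### One-variable calculus along real lines in `ℂ` -/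

/-- Derivative of a differentiable `f : ℂ → F` along the real line `t ↦ z + t • v`
(adapted from `Literature.Analysis.FluidPDE.hasDerivAt_comp_line`). -/
private theorem hasDerivAt_line {F : Type*} [NormedAddCommGroup F] [NormedSpace ℝ F]
    {f : ℂ → F} (hf : Differentiable ℝ f) (z v : ℂ) (t : ℝ) :
    HasDerivAt (fun s : ℝ => f (z + s • v)) (fderiv ℝ f (z + t • v) v) t := by
  have hl : HasDerivAt (fun s : ℝ => z + s • v) v t := by
    simpa using ((hasDerivAt_id t).smul_const v).const_add z
  exact (hf (z + t • v)).hasFDerivAt.comp_hasDerivAt t hl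

/-- Second derivative along the line: for `f` of class `C²`, `t ↦ Df(z + t v) v` has derivative
`D²f(z)(v, v)` at `t = 0`. -/
private theorem hasDerivAt_line_fderiv {f : ℂ → ℝ} (hf : ContDiff ℝ 2 f) (z v : ℂ) :
    HasDerivAt (fun s : ℝ => fderiv ℝ f (z + s • v) v) (fderiv ℝ (fderiv ℝ f) z v v) 0 := by
  have hD : Differentiable ℝ (fderiv ℝ f) :=
    (hf.fderiv_right (m := 1) (by norm_num)).differentiable one_ne_zero
  have h1 := hasDerivAt_line hD z v 0
  have h2 := h1.clm_apply (hasDerivAt_const (0 : ℝ) v)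
  simpa using h2

/-- One-dimensional second-derivative test, necessary form: at a local maximum where `φ` is
continuous, `φ'' ≤ 0` (otherwise the sufficient second-derivative test makes the point also a
local minimum, `φ` is locally constant and `φ'' = 0` there). -/
private theorem deriv_deriv_nonpos_of_isLocalMax {φ : ℝ → ℝ} {t₀ : ℝ} (h : IsLocalMax φ t₀)
    (hc : ContinuousAt φ t₀) : deriv (deriv φ) t₀ ≤ 0 := by
  by_contra hpos
  have hpos' : 0 < deriv (deriv φ) t₀ := lt_of_not_ge hpos
  have hmin : IsLocalMin φ t₀ := isLocalMin_of_deriv_deriv_pos hpos' h.deriv_eq_zero hc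
  have heq : φ =ᶠ[𝓝 t₀] fun _ => φ t₀ :=
    (h.and hmin).mono fun s hs => le_antisymm hs.1 hs.2
  have h2 : deriv (deriv φ) t₀ = deriv (deriv fun _ : ℝ => φ t₀) t₀ := heq.deriv.deriv_eq
  rw [h2] at hpos'
  simp at hpos'

/-- First- and second-order conditions at a local maximum, for a function with an everywhere
derivative `ψ'` which is itself differentiable at the point: `ψ'(t₀) = 0` and `ψ''(t₀) ≤ 0`. -/
private theorem deriv_test {ψ ψ' : ℝ → ℝ} {d t₀ : ℝ} (hψ : ∀ t, HasDerivAt ψ (ψ' t) t)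
    (hψ' : HasDerivAt ψ' d t₀) (hmax : IsLocalMax ψ t₀) : ψ' t₀ = 0 ∧ d ≤ 0 := by
  have h1 : deriv ψ = ψ' := funext fun t => (hψ t).deriv
  refine ⟨?_, ?_⟩
  · rw [← (hψ t₀).deriv]
    exact hmax.deriv_eq_zero
  · have h2 : deriv (deriv ψ) t₀ = d := by rw [h1]; exact hψ'.deriv
    rw [← h2]
    exact deriv_deriv_nonpos_of_isLocalMax hmax (hψ t₀).continuousAt

/-- `‖z + t v‖² = ‖z‖² + 2t⟨z, v⟩ + t²‖v‖²` in real coordinates. -/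
private theorem norm_sq_line (z v : ℂ) (t : ℝ) :
    ‖z + t • v‖ ^ 2 =
      ‖z‖ ^ 2 + 2 * (z.re * v.re + z.im * v.im) * t + (v.re ^ 2 + v.im ^ 2) * t ^ 2 := by
  simp only [Complex.sq_norm, Complex.normSq_apply, Complex.add_re, Complex.add_im,
    Complex.smul_re, Complex.smul_im, smul_eq_mul]
  ring

/-- Derivative of the quadratic `s ↦ A - 2Bs - Ns²`. -/
private theorem hasDerivAt_quad (A B N t : ℝ) :
    HasDerivAt (fun s : ℝ => A - 2 * B * s - N * s ^ 2) (-(2 * B) - N * (2 * t)) t := by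
  have h1 : HasDerivAt (fun s : ℝ => 2 * B * s) (2 * B) t := by
    simpa using (hasDerivAt_id' t).const_mul (2 * B)
  have h2 : HasDerivAt (fun s : ℝ => N * s ^ 2) (N * (2 * t)) t := by
    simpa using (hasDerivAt_pow 2 t).const_mul N
  exact (h1.const_sub A).fun_sub h2

/-- Derivative of the affine function `s ↦ -(2B) - N(2s)`. -/
private theorem hasDerivAt_quad' (B N t : ℝ) :
    HasDerivAt (fun s : ℝ => -(2 * B) - N * (2 * s)) (-(N * 2)) t := by
  have h : HasDerivAt (fun s : ℝ => N * (2 * s)) (N * 2) t := by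
    simpa using ((hasDerivAt_id' t).const_mul 2).const_mul N
  exact h.const_sub (-(2 * B))

/-! ### The line test at an interior maximum of `f · (R² - |z|²)²` -/

/-- **Line test.** At a local maximum `z` of `w ↦ f(w) (R² - ‖w‖²)²` (`f` of class `C²`), the
first derivative of the restriction to the real line `t ↦ z + t v` vanishes and the second one is
`≤ 0`; written out with `A = R² - ‖z‖²`, `B = ⟨z, v⟩ = re z re v + im z im v`, `N = ‖v‖²`:
`Df(z)v · A² - 4AB f(z) = 0` and `D²f(z)(v,v) A² - 8AB Df(z)v + f(z)(8B² - 4AN) ≤ 0`. -/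
private theorem line_test {f : ℂ → ℝ} (hf : ContDiff ℝ 2 f) {R : ℝ} {z : ℂ}
    (hmax : IsLocalMax (fun w => f w * (R ^ 2 - ‖w‖ ^ 2) ^ 2) z) (v : ℂ) :
    fderiv ℝ f z v * (R ^ 2 - ‖z‖ ^ 2) ^ 2 -
        4 * (R ^ 2 - ‖z‖ ^ 2) * (z.re * v.re + z.im * v.im) * f z = 0 ∧
      fderiv ℝ (fderiv ℝ f) z v v * (R ^ 2 - ‖z‖ ^ 2) ^ 2 -
          8 * (R ^ 2 - ‖z‖ ^ 2) * (z.re * v.re + z.im * v.im) * fderiv ℝ f z v +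
        f z * (8 * (z.re * v.re + z.im * v.im) ^ 2 -
          4 * (R ^ 2 - ‖z‖ ^ 2) * (v.re ^ 2 + v.im ^ 2)) ≤ 0 := by
  have hfd : Differentiable ℝ f := hf.differentiable (by norm_num)
  -- the restriction of the weight to the line is an explicit quartic
  have hfun : (fun s : ℝ => f (z + s • v) * (R ^ 2 - ‖z + s • v‖ ^ 2) ^ 2) = fun s =>
      f (z + s • v) * ((R ^ 2 - ‖z‖ ^ 2 - 2 * (z.re * v.re + z.im * v.im) * s -
        (v.re ^ 2 + v.im ^ 2) * s ^ 2) * (R ^ 2 - ‖z‖ ^ 2 - 2 * (z.re * v.re + z.im * v.im) * s -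
        (v.re ^ 2 + v.im ^ 2) * s ^ 2)) := by
    funext s
    rw [norm_sq_line]
    ring
  -- the restriction has a local maximum at `0`
  have hmax0 : IsLocalMax (fun s : ℝ => f (z + s • v) * (R ^ 2 - ‖z + s • v‖ ^ 2) ^ 2) 0 := by
    have hz : IsLocalMax (fun w => f w * (R ^ 2 - ‖w‖ ^ 2) ^ 2) ((fun s : ℝ => z + s • v) 0) := by
      simpa using hmax
    exact hz.comp_continuous (g := fun s : ℝ => z + s • v) (by fun_prop)
  rw [hfun] at hmax0
  set A : ℝ := R ^ 2 - ‖z‖ ^ 2 with hA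
  set B : ℝ := z.re * v.re + z.im * v.im with hB
  set N : ℝ := v.re ^ 2 + v.im ^ 2 with hN
  -- derivatives along the line
  have hf1 : ∀ t : ℝ, HasDerivAt (fun s : ℝ => f (z + s • v)) (fderiv ℝ f (z + t • v) v) t :=
    hasDerivAt_line hfd z v
  have hf2 := hasDerivAt_line_fderiv hf z v
  have hP : ∀ t : ℝ,
      HasDerivAt (fun s : ℝ => A - 2 * B * s - N * s ^ 2) (-(2 * B) - N * (2 * t)) t :=
    fun t => hasDerivAt_quad A B N t
  have hP' := hasDerivAt_quad' B N 0
  have hψ := fun t => (hf1 t).fun_mul ((hP t).fun_mul (hP t))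
  have hψ' := (hf2.fun_mul ((hP 0).fun_mul (hP 0))).fun_add
    ((hf1 0).fun_mul ((hP'.fun_mul (hP 0)).fun_add ((hP 0).fun_mul hP')))
  obtain ⟨h1, h2⟩ := deriv_test hψ hψ' hmax0
  simp only [zero_smul, add_zero] at h1 h2
  constructor
  · linarith [hA, hB, hN]
  · linarith [hA, hB, hN]

/-! ### The comparison on a disc -/

/-- **The pointwise algebra** of the Ahlfors–Osserman comparison at an interior positive maximum:
from the two first-order relations, the two second-order inequalities and the curvature
hypothesis one gets `c L A² ≤ 4(A + x² + y²)` (`= 4R²`). -/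
private theorem algebra_step {c L A x y p q s u : ℝ} (hL : 0 < L) (hA : 0 < A)
    (ha1 : p * A ^ 2 - 4 * A * x * L = 0) (ha2 : q * A ^ 2 - 4 * A * y * L = 0)
    (hb1 : s * A ^ 2 - 8 * A * x * p + L * (8 * x ^ 2 - 4 * A) ≤ 0)
    (hb2 : u * A ^ 2 - 8 * A * y * q + L * (8 * y ^ 2 - 4 * A) ≤ 0)
    (hd : 2 * c * L ^ 3 ≤ L * (s + u) - (p ^ 2 + q ^ 2)) :
    c * L * A ^ 2 ≤ 4 * (A + x ^ 2 + y ^ 2) := by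
  have ha1' : p * A = 4 * L * x := mul_left_cancel₀ hA.ne' (by linear_combination ha1)
  have ha2' : q * A = 4 * L * y := mul_left_cancel₀ hA.ne' (by linear_combination ha2)
  have i1 := mul_nonpos_of_nonneg_of_nonpos hL.le hb1
  have i2 := mul_nonpos_of_nonneg_of_nonpos hL.le hb2
  have i3 := mul_le_mul_of_nonneg_left hd (sq_nonneg A)
  have e1 : A * x * p * L = 4 * L ^ 2 * x ^ 2 := by linear_combination (L * x) * ha1'
  have e2 : A ^ 2 * p ^ 2 = 16 * L ^ 2 * x ^ 2 := by
    linear_combination (p * A + 4 * L * x) * ha1'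
  have e3 : A * y * q * L = 4 * L ^ 2 * y ^ 2 := by linear_combination (L * y) * ha2'
  have e4 : A ^ 2 * q ^ 2 = 16 * L ^ 2 * y ^ 2 := by
    linear_combination (q * A + 4 * L * y) * ha2'
  have key : 2 * c * L ^ 3 * A ^ 2 ≤ 8 * L ^ 2 * (A + x ^ 2 + y ^ 2) := by linarith
  have h2L : 0 < 2 * L ^ 2 := by positivity
  have key' : 2 * L ^ 2 * (c * L * A ^ 2) ≤ 2 * L ^ 2 * (4 * (A + x ^ 2 + y ^ 2)) := by linarith
  exact le_of_mul_le_mul_left key' h2L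

/-- **Comparison with the Poincaré density of a disc.** Under the hypotheses of the stub, for
every `R > 0` and `‖z‖ ≤ R`: `c λ(z) (R² - ‖z‖²)² ≤ 4R²`, i.e. `λ ≤ 4R²/(c(R² - |z|²)²)` on
`D_R` (maximum of `λ (R² - |z|²)²` over the closed disc, line test in the directions `1`, `I`,
and `algebra_step`). -/
private theorem bound_on_disc {c : ℝ} {lam : ℂ → ℝ} (hc : 0 < c) (hlam : ContDiff ℝ 2 lam)
    (h0 : ∀ z, 0 ≤ lam z)
    (hineq : ∀ z, 2 * c * (lam z) ^ 3 ≤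
      lam z * (Δ lam) z - ((fderiv ℝ lam z 1) ^ 2 + (fderiv ℝ lam z Complex.I) ^ 2))
    {R : ℝ} (hR : 0 < R) {z : ℂ} (hz : ‖z‖ ≤ R) :
    c * lam z * (R ^ 2 - ‖z‖ ^ 2) ^ 2 ≤ 4 * R ^ 2 := by
  have hqc : Continuous fun w : ℂ => lam w * (R ^ 2 - ‖w‖ ^ 2) ^ 2 := by
    have := hlam.continuous
    fun_prop
  obtain ⟨z₂, hz₂, hmax⟩ := (isCompact_closedBall (0 : ℂ) R).exists_isMaxOn
    ⟨0, Metric.mem_closedBall_self hR.le⟩ hqc.continuousOn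
  have hzK : z ∈ Metric.closedBall (0 : ℂ) R := mem_closedBall_zero_iff.2 hz
  have hqz : lam z * (R ^ 2 - ‖z‖ ^ 2) ^ 2 ≤ lam z₂ * (R ^ 2 - ‖z₂‖ ^ 2) ^ 2 :=
    isMaxOn_iff.1 hmax z hzK
  have key : c * (lam z₂ * (R ^ 2 - ‖z₂‖ ^ 2) ^ 2) ≤ 4 * R ^ 2 := by
    rcases eq_or_lt_of_le (h0 z₂) with hL0 | hLpos
    · have h : lam z₂ * (R ^ 2 - ‖z₂‖ ^ 2) ^ 2 = 0 := by rw [← hL0]; ring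
      rw [h, mul_zero]
      positivity
    rcases eq_or_lt_of_le (mem_closedBall_zero_iff.1 hz₂) with hzR | hzR
    · have h : lam z₂ * (R ^ 2 - ‖z₂‖ ^ 2) ^ 2 = 0 := by rw [hzR]; ring
      rw [h, mul_zero]
      positivity
    -- an interior maximum with `lam z₂ > 0`
    have hApos : 0 < R ^ 2 - ‖z₂‖ ^ 2 := by
      nlinarith [mul_pos (sub_pos.2 hzR) (add_pos_of_pos_of_nonneg hR (norm_nonneg z₂))]
    have hloc : IsLocalMax (fun w => lam w * (R ^ 2 - ‖w‖ ^ 2) ^ 2) z₂ :=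
      hmax.isLocalMax (Metric.closedBall_mem_nhds_of_mem (mem_ball_zero_iff.2 hzR))
    obtain ⟨ha1, hb1⟩ := line_test hlam hloc 1
    obtain ⟨ha2, hb2⟩ := line_test hlam hloc Complex.I
    simp only [Complex.one_re, Complex.one_im, Complex.I_re, Complex.I_im] at ha1 hb1 ha2 hb2
    have hΔ : (Δ lam) z₂ = fderiv ℝ (fderiv ℝ lam) z₂ 1 1 +
        fderiv ℝ (fderiv ℝ lam) z₂ Complex.I Complex.I := by
      rw [InnerProductSpace.laplacian_eq_iteratedFDeriv_complexPlane lam]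
      simp [iteratedFDeriv_two_apply]
    have hd := hineq z₂
    rw [hΔ] at hd
    have hR2 : ‖z₂‖ ^ 2 = z₂.re ^ 2 + z₂.im ^ 2 := by
      rw [Complex.sq_norm, Complex.normSq_apply]; ring
    have key := algebra_step (c := c) hLpos hApos (x := z₂.re) (y := z₂.im)
      (p := fderiv ℝ lam z₂ 1) (q := fderiv ℝ lam z₂ Complex.I)
      (s := fderiv ℝ (fderiv ℝ lam) z₂ 1 1)
      (u := fderiv ℝ (fderiv ℝ lam) z₂ Complex.I Complex.I)
      (by linarith) (by linarith) (by linarith) (by linarith) (by linarith)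
    linarith
  calc c * lam z * (R ^ 2 - ‖z‖ ^ 2) ^ 2 = c * (lam z * (R ^ 2 - ‖z‖ ^ 2) ^ 2) := by ring
    _ ≤ c * (lam z₂ * (R ^ 2 - ‖z₂‖ ^ 2) ^ 2) := mul_le_mul_of_nonneg_left hqz hc.le
    _ ≤ 4 * R ^ 2 := key

/-! ### The stub -/

/-- **Stub (P2) — Ahlfors–Schwarz–Osserman on the plane.** A `C²` function `λ ≥ 0` on `ℂ` with
`2c λ³ ≤ λ Δλ - |∇λ|²` everywhere (`c > 0`; `|∇λ|² = (∂ₓλ)² + (∂_yλ)²`, `Δ` Mathlib's Laplacian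
for the real inner product space `ℂ`) vanishes identically: where `λ > 0` the metric `λ|dz|²`
has curvature `≤ -c`, so `λ ≤ 4R²/(c(R²-|z|²)²)` on every disc `D_R` (`bound_on_disc`, the
maximum principle for `λ (R² - |z|²)²`), and `R → ∞`. (Ahlfors 1938; Osserman 1957.) -/
theorem stub_ahlforsOsserman : ∀ (c : ℝ) (lam : ℂ → ℝ), 0 < c → ContDiff ℝ 2 lam →
    (∀ z, 0 ≤ lam z) →
    (∀ z, 2 * c * (lam z) ^ 3 ≤
      lam z * (Δ lam) z - ((fderiv ℝ lam z 1) ^ 2 + (fderiv ℝ lam z Complex.I) ^ 2)) →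
    ∀ z, lam z = 0 := by
  intro c lam hc hlam h0 hineq z
  refine le_antisymm ?_ (h0 z)
  by_contra hpos
  have hpos' : 0 < lam z := lt_of_not_ge hpos
  have hm0 : 0 < c * lam z := mul_pos hc hpos'
  -- the comparison on the disc of radius `R = ‖z‖ + S`, `S` large
  obtain ⟨S, hS1, hSz, hSm⟩ : ∃ S : ℝ, 1 ≤ S ∧ ‖z‖ ≤ S ∧ 16 / (c * lam z) < S :=
    ⟨max (max 1 ‖z‖) (16 / (c * lam z) + 1), le_trans (le_max_left _ _) (le_max_left _ _),
      le_trans (le_max_right _ _) (le_max_left _ _),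
      lt_of_lt_of_le (lt_add_one _) (le_max_right _ _)⟩
  have hS0 : 0 < S := lt_of_lt_of_le one_pos hS1
  have hR : 0 < ‖z‖ + S := add_pos_of_nonneg_of_pos (norm_nonneg z) hS0
  have hb := bound_on_disc hc hlam h0 hineq hR (z := z) (by linarith)
  -- `R² - ‖z‖² = S (2‖z‖ + S) ≥ S²` and `4R² ≤ 16 S²`, so `m S⁴ ≤ 16 S²` and `m S² ≤ 16`
  have h1 : S ^ 2 ≤ (‖z‖ + S) ^ 2 - ‖z‖ ^ 2 := by
    nlinarith [mul_nonneg (norm_nonneg z) hS0.le]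
  have h2 : 4 * (‖z‖ + S) ^ 2 ≤ 16 * S ^ 2 := by
    have h3S : 0 ≤ 3 * S + ‖z‖ := by positivity
    nlinarith [mul_nonneg (sub_nonneg.2 hSz) h3S]
  have h3 : c * lam z * (S ^ 2) ^ 2 ≤ c * lam z * ((‖z‖ + S) ^ 2 - ‖z‖ ^ 2) ^ 2 :=
    mul_le_mul_of_nonneg_left (pow_le_pow_left₀ (sq_nonneg S) h1 2) hm0.le
  have h4 : c * lam z * (S ^ 2) ^ 2 ≤ 16 * S ^ 2 := by linarith
  have h5 : c * lam z * S ^ 2 ≤ 16 := by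
    have hS2 : 0 < S ^ 2 := by positivity
    have h : S ^ 2 * (c * lam z * S ^ 2) ≤ S ^ 2 * 16 := by linarith
    exact le_of_mul_le_mul_left h hS2
  -- but `S > 16 / m` and `S ≥ 1` give `m S² ≥ m S > 16`
  have h6 : 16 < c * lam z * S := by
    have h := (div_lt_iff₀ hm0).1 hSm
    linarith
  have h7 : c * lam z * S ≤ c * lam z * S ^ 2 := by
    nlinarith [mul_nonneg (mul_nonneg hm0.le hS0.le) (sub_nonneg.2 hS1)]
  linarith

end Summit.SmoothPoincare4.SmoothPoincare4.Cruxes.HyperbolicEnd.Sketch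

end
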